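import Literature.MathematicalPhysics.QuantumLattice.FermionicTreeExpansionTrees
import Literature.Probability.LatticeModels.BattleFederbushTreeDecay
import HarnessLib

/-!
# The single-scale `n!`-free estimate: summing the truncated expectation over the positions

Topic `Literature/MathematicalPhysics/QuantumLattice`; the assembly of the tree expansion bound
(`FermionicTreeExpansionTrees.lean`: `‖𝓔ᵀ(W)‖ ≤ Σ_T treeBound T`), the tree-decay lemma
(`BattleFederbushTreeDecay.lean`: `Σ_x ∏_ℓ g_ℓ(x_child - x_parent) = ∏_ℓ ‖g_ℓ‖₁`) and Cayley's count
(`BattleFederbushTrees.lean`) into the basic estimate of fermionic cluster expansions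
(Benfatto–Giuliani–Mastropietro 2006, the bound (2.77) at a single scale; Mastropietro 2008,
§2.9–2.10, (2.118)–(2.126); Gentile–Mastropietro 2001, §2): for local clusters `x ∈ ι` sitting at
positions `p x` in a finite abelian group `Λ` (a torus), field pairs `f` at the position of their
cluster `c f`, and a propagator in Gram form with unit Gram vectors and a translation invariant,
even bound `|⟨ψ̄_f ψ_{f'}⟩| ≤ γ(p(c f) - p(c f'))`,

`Σ_{p : p v = a} ‖𝓔ᵀ_p(all clusters)‖ ≤ |ι|^{|ι|-2} · (2 n² ‖γ‖₁)^{|ι|-1}`  (`sum_norm_ursellOf_moment_le`),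

`n` a bound on the number of field pairs per cluster — no factorial in the number of clusters beyond
Cayley's `|ι|^{|ι|-2} ≤ |ι|! e^{|ι|}`, which is compensated by the `1/|ι|!` of the exponential; this is
the mechanism of convergence of the expansion in the running coupling at each scale.

## Main results (namespace `Literature.MathematicalPhysics.QuantumLattice.FermionicTree`)

* `card_filter_pairType_le` — at most `2n²` field lines of a given cluster type;
* `assignBound_le_prod` — `assignBound L ≤ ∏_{ℓ ∈ L} (2n² M_ℓ)` for unit Gram vectors and a line
  bound `M`;
* `prod_map_lines_eq_lineWeightProd`, `sum_lineWeightProd_comp_eq_pow` — the lines of a spanning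
  script against an even translation invariant weight, summed over the positions;
* `sum_norm_ursellOf_moment_le` — the estimate displayed above.

## Sources

G. Benfatto, A. Giuliani, V. Mastropietro, Ann. Henri Poincaré 7 (2006), (2.66)–(2.68a), (2.77)
(`BenfattoGiulianiMastropietro2006`); V. Mastropietro, *Non-Perturbative Renormalization* (2008),
§2.9–2.10 (`Mastropietro2008`); D. C. Brydges, Les Houches 1984 (`Brydges1986`).  Everything is
proved; no named fact.
-/

noncomputable section

open MvPolynomial Finsupp Matrix Finset Literature.RingTheory.MvPolynomial
open Literature.Probability.LatticeModels Literature.Probability.LatticeModels.BattleFederbush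
open Literature.MeasureTheory.Integral Literature.Analysis.InnerProduct
open scoped InnerProductSpace

namespace Literature.MathematicalPhysics.QuantumLattice

namespace FermionicTree

variable {𝕜 : Type*} [RCLike 𝕜] {E : Type*} [NormedAddCommGroup E] [InnerProductSpace 𝕜 E]
variable {ι : Type*} [DecidableEq ι] {F : Type*} [Fintype F] [LinearOrder F]
variable (c : F → ι)

/-! ### Counting the field lines of a cluster type -/

omit [Fintype F] [LinearOrder F] in
/-- There are at most `2 n²` field lines `(a, b)` of a given cluster type `{c a, c b} = ℓ` when every
cluster has at most `n` field pairs. [folklore] -/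
theorem card_filter_pairType_le {r : ℕ} (e : Fin r → F) (n : ℕ)
    (hn : ∀ x : ι, (univ.filter fun a : Fin r => c (e a) = x).card ≤ n) (ℓ : Sym2 ι) :
    (univ.filter fun q : Fin r × Fin r => s(c (e q.1), c (e q.2)) = ℓ).card ≤ 2 * n ^ 2 := by
  refine Sym2.inductionOn ℓ fun x x' => ?_
  set S : ι → Finset (Fin r) := fun z => univ.filter fun a : Fin r => c (e a) = z with hS
  calc (univ.filter fun q : Fin r × Fin r => s(c (e q.1), c (e q.2)) = s(x, x')).card
      ≤ ((S x ×ˢ S x') ∪ (S x' ×ˢ S x)).card := by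
        refine card_le_card fun q hq => ?_
        rw [mem_filter] at hq
        rcases Sym2.eq_iff.1 hq.2 with ⟨h1, h2⟩ | ⟨h1, h2⟩
        · exact mem_union_left _ (mem_product.2 ⟨by simp [hS, h1], by simp [hS, h2]⟩)
        · exact mem_union_right _ (mem_product.2 ⟨by simp [hS, h1], by simp [hS, h2]⟩)
    _ ≤ (S x ×ˢ S x').card + (S x' ×ˢ S x).card := card_union_le _ _
    _ ≤ n * n + n * n := by
        rw [card_product, card_product]
        exact add_le_add (Nat.mul_le_mul (hn x) (hn x')) (Nat.mul_le_mul (hn x') (hn x))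
    _ = 2 * n ^ 2 := by ring

/-! ### Bounding the recursive Gram bound by a product over the lines -/

variable (A B : F → E)

omit [Fintype F] in
/-- **The recursive bound is at most the product over the lines of `2n² M_ℓ`** when the Gram vectors
have norm at most one (so that the final Gram–Hadamard product is `≤ 1`) and the propagator of a
field line of cluster type `ℓ` is bounded by `M_ℓ`. [folklore] -/
theorem assignBound_le_prod {r : ℕ} (e : Fin r → F) (hA : ∀ a, ‖A (e a)‖ ≤ 1) (hB : ∀ b, ‖B (e b)‖ ≤ 1)
    (M : Sym2 ι → ℝ) (hM0 : ∀ ℓ, 0 ≤ M ℓ)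
    (hG : ∀ a b, ‖(⟪A (e a), B (e b)⟫_𝕜 : 𝕜)‖ ≤ M s(c (e a), c (e b)))
    (n : ℕ) (hn : ∀ x : ι, (univ.filter fun a : Fin r => c (e a) = x).card ≤ n) :
    ∀ (L : List (Sym2 ι)) (I : Finset F) (jm : F → F),
      assignBound 𝕜 c A B e L I jm ≤ (L.map fun ℓ => 2 * (n : ℝ) ^ 2 * M ℓ).prod
  | [], I, jm => by
    rw [List.map_nil, List.prod_nil, assignBound]
    exact mul_le_one₀ (prod_le_one (fun _ _ => norm_nonneg _) fun a _ => hA a)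
      (prod_nonneg fun _ _ => norm_nonneg _) (prod_le_one (fun _ _ => norm_nonneg _) fun b _ => hB b)
  | ℓ :: L, I, jm => by
    rw [List.map_cons, List.prod_cons, assignBound]
    set R := (L.map fun ℓ => 2 * (n : ℝ) ^ 2 * M ℓ).prod with hR
    have hR0 : 0 ≤ R := by
      refine List.prod_nonneg fun t ht => ?_
      obtain ⟨ℓ', -, rfl⟩ := List.mem_map.1 ht
      exact mul_nonneg (by positivity) (hM0 ℓ')
    calc ∑ i, ∑ j, (if e i ∉ I ∧ s(c (e i), c (e j)) = ℓ then
            ‖(⟪A (e i), B (e j)⟫_𝕜 : 𝕜)‖ * assignBound 𝕜 c A B e L (insert (e i) I) (Function.update jm (e i) (e j))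
          else 0)
        ≤ ∑ i, ∑ j, (if s(c (e i), c (e j)) = ℓ then M ℓ * R else 0) := by
          refine sum_le_sum fun i _ => sum_le_sum fun j _ => ?_
          by_cases h2 : s(c (e i), c (e j)) = ℓ
          · rw [if_pos h2]
            split_ifs with h1
            · exact mul_le_mul (h2 ▸ hG i j) (assignBound_le_prod e hA hB M hM0 hG n hn L _ _)
                (assignBound_nonneg c A B e L _ _) (hM0 ℓ)
            · exact mul_nonneg (hM0 ℓ) hR0
          · rw [if_neg h2, if_neg (fun h => h2 h.2)]
      _ = (univ.filter fun q : Fin r × Fin r => s(c (e q.1), c (e q.2)) = ℓ).card * (M ℓ * R) := by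
          rw [← Fintype.sum_prod_type', Finset.sum_ite, sum_const_zero, add_zero, sum_const, nsmul_eq_mul]
      _ ≤ (2 * n ^ 2 : ℕ) * (M ℓ * R) :=
          mul_le_mul_of_nonneg_right (Nat.cast_le.2 (card_filter_pairType_le c e n hn ℓ)) (mul_nonneg (hM0 ℓ) hR0)
      _ = 2 * (n : ℝ) ^ 2 * M ℓ * R := by push_cast; ring

/-- Pulling a constant out of a list product. [folklore] -/
theorem prod_map_const_mul {α : Type*} (L : List α) (C : ℝ) (f : α → ℝ) :
    (L.map fun a => C * f a).prod = C ^ L.length * (L.map f).prod := by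
  induction L with
  | nil => simp
  | cons a L ih => rw [List.map_cons, List.prod_cons, ih, List.map_cons, List.prod_cons, List.length_cons, pow_succ]; ring

/-! ### The lines of a spanning script against an even translation invariant weight -/

section Positions

variable {Λ : Type*} [AddCommGroup Λ] {v : ι}

/-- The even line weight `{u, w} ↦ γ(p u - p w)` on cluster pairs. [folklore] -/
def lineWeight (γ : Λ → ℝ) (hγ : ∀ z, γ (-z) = γ z) (p : ι → Λ) : Sym2 ι → ℝ :=
  Sym2.lift ⟨fun u w => γ (p u - p w), fun u w => by show γ (p u - p w) = γ (p w - p u); rw [← hγ, neg_sub]⟩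

omit [DecidableEq ι] in
/-- `lineWeight` on a pair. [folklore] -/
@[simp] theorem lineWeight_mk (γ : Λ → ℝ) (hγ : ∀ z, γ (-z) = γ z) (p : ι → Λ) (u w : ι) :
    lineWeight γ hγ p s(u, w) = γ (p u - p w) := rfl

omit [DecidableEq ι] in
/-- The product of the line weights of a script is the `lineWeightProd` of the tree-decay lemma at
the positions of its points. [folklore] -/
theorem prod_map_lines_eq_lineWeightProd (γ : Λ → ℝ) (hγ : ∀ z, γ (-z) = γ z) (p : ι → Λ) :
    ∀ {k : ℕ} (s : Script v k),
      (s.lines.map (lineWeight γ hγ p)).prod = s.lineWeightProd (fun _ => γ) (p ∘ s.y)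
  | _, Script.nil => by simp [Script.lines]
  | _, Script.snoc s i z => by
    rw [Script.lines, List.map_append, List.prod_append, List.map_singleton, List.prod_singleton,
      Script.lineWeightProd_snoc, prod_map_lines_eq_lineWeightProd γ hγ p s, lineWeight_mk, ← hγ, neg_sub]
    congr 1
    · congr 1
      funext m
      simp only [Function.comp_apply, Script.y_snoc_castSucc]
    · simp only [Function.comp_apply, Script.y_snoc_last, Script.y_snoc_castSucc]

variable [Fintype ι] [Fintype Λ] [DecidableEq Λ]

/-- **Summing the line weights of a spanning script over the positions** (root held at `a`):
`Σ_{p : p v = a} ∏_ℓ γ(p u_ℓ - p w_ℓ) = (Σ_z γ z)^k` for a valid script with `k` lines through all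
clusters (the tree-decay lemma `Script.sum_lineWeightProd_eq_prod_sum`). [folklore] -/
theorem sum_lineWeightProd_comp_eq_pow {k : ℕ} (s : Script v k) (hs : s.Valid) (huniv : univ.image s.y = univ)
    (γ : Λ → ℝ) (a : Λ) :
    ∑ p ∈ univ.filter (fun p : ι → Λ => p v = a), s.lineWeightProd (fun _ => γ) (p ∘ s.y) = (∑ z, γ z) ^ k := by
  have hbij : Function.Bijective s.y :=
    ⟨Script.y_injective s hs, fun x => by
      obtain ⟨m, -, hm⟩ := mem_image.1 (huniv.symm ▸ mem_univ x); exact ⟨m, hm⟩⟩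
  set eqv : Fin (k + 1) ≃ ι := Equiv.ofBijective s.y hbij with heqv
  set Φ : (ι → Λ) ≃ (Fin (k + 1) → Λ) := eqv.symm.arrowCongr (Equiv.refl Λ) with hΦ
  have hΦ' : ∀ p : ι → Λ, Φ p = p ∘ s.y := fun p => by
    funext m; simp [hΦ, heqv, Equiv.arrowCongr]
  rw [show (∑ z, γ z) ^ k = ∏ _t : Fin k, ∑ z, γ z by rw [prod_const, card_univ, Fintype.card_fin],
    ← Script.sum_lineWeightProd_eq_prod_sum s (fun _ => γ) a, Finset.sum_filter, Finset.sum_filter, ← Φ.symm.sum_comp]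
  refine sum_congr rfl fun x _ => ?_
  have hx : Φ.symm x ∘ s.y = x := by rw [← hΦ' (Φ.symm x), Equiv.apply_symm_apply]
  have h0 : Φ.symm x v = x 0 := by
    have := congrFun hx 0
    rwa [Function.comp_apply, Script.y_zero] at this
  rw [hx, h0]

end Positions

/-! ### The estimate -/

section Main

variable {Λ : Type*} [AddCommGroup Λ] [Fintype Λ] [DecidableEq Λ] [Fintype ι] {v : ι}
variable (α β : F → Λ → E)

omit [Fintype ι] in
/-- The number of field pairs of the cluster `x` among the enumerated fields of `W` is at most the
number of field pairs of `x`. [folklore] -/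
theorem card_filter_enum_le (W : Finset ι) (x : ι) :
    (univ.filter fun a : Fin (fieldsOf c W).card => c (enum c W a) = x).card ≤ (fieldsOf c {x}).card := by
  refine card_le_card_of_injOn (fun a => enum c W a) (fun a ha => ?_) fun a _ b _ h => (enum c W).injective h
  rw [mem_coe, mem_filter] at ha
  rw [mem_coe, mem_fieldsOf, mem_singleton]
  exact ha.2

/-- **The single-scale `n!`-free estimate** (Benfatto–Giuliani–Mastropietro 2006, the bound (2.77)
at one scale; Mastropietro 2008, §2.9–2.10): for local clusters `x ∈ ι` at positions `p x ∈ Λ` (a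
finite abelian group), field pairs at the position of their cluster, a propagator in Gram form
`⟨ψ̄_f ψ_{f'}⟩ = ⟪α_f(p(c f)), β_{f'}(p(c f'))⟫` with `‖α‖, ‖β‖ ≤ 1` and an even translation invariant
bound `|⟪α_f(z), β_{f'}(z')⟫| ≤ γ(z - z')`, and at most `n` field pairs per cluster,
`Σ_{p : p v = a} ‖𝓔ᵀ_p(ι)‖ ≤ |ι|^{|ι|-2} · (2 n² Σ_z γ z)^{|ι|-1}`: Cayley's count of the anchored cluster
trees, `2n²` field lines per cluster line, the `ℓ¹` norm of `γ` per tree line (tree decay), and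
the Gram–Hadamard bound `≤ 1` for the remaining determinant, uniformly in the interpolation.
[cite: BenfattoGiulianiMastropietro2006, (2.66)-(2.77)] -/
theorem sum_norm_ursellOf_moment_le (hα : ∀ f z, ‖α f z‖ ≤ 1) (hβ : ∀ f z, ‖β f z‖ ≤ 1)
    (γ : Λ → ℝ) (hγ0 : ∀ z, 0 ≤ γ z) (hγ : ∀ z, γ (-z) = γ z)
    (hG : ∀ f f' z z', ‖(⟪α f z, β f' z'⟫_𝕜 : 𝕜)‖ ≤ γ (z - z'))
    (n : ℕ) (hn : ∀ x : ι, (fieldsOf c {x}).card ≤ n) (a : Λ) :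
    ∑ p ∈ univ.filter (fun p : ι → Λ => p v = a),
        ‖ursellOf (moment c (gramProp 𝕜 (fun f => α f (p (c f))) (fun f => β f (p (c f))))) univ‖ ≤
      (Fintype.card ι : ℝ) ^ (Fintype.card ι - 2) * (2 * (n : ℝ) ^ 2 * ∑ z, γ z) ^ (Fintype.card ι - 1) := by
  have hv : v ∈ (univ : Finset ι) := mem_univ v
  set Cst : ℝ := (2 * (n : ℝ) ^ 2 * ∑ z, γ z) ^ (Fintype.card ι - 1) with hCst
  have hγ1 : 0 ≤ ∑ z, γ z := sum_nonneg fun z _ => hγ0 z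
  -- Step 1: the tree-form bound at every position, and exchange of the sums
  have step1 : ∀ p : ι → Λ,
      ‖ursellOf (moment c (gramProp 𝕜 (fun f => α f (p (c f))) (fun f => β f (p (c f))))) univ‖ ≤
        ∑ T ∈ lineSets v (univ : Finset ι), treeBound (𝕜 := 𝕜) c (fun f => α f (p (c f))) (fun f => β f (p (c f))) univ T :=
    fun p => norm_ursellOf_moment_le_sum_lineSets c _ _ univ hv
  refine (sum_le_sum fun p _ => step1 p).trans ?_
  rw [Finset.sum_comm]
  -- Step 2: each anchored cluster tree contributes at most `Cst`
  have step2 : ∀ T ∈ lineSets v (univ : Finset ι),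
      ∑ p ∈ univ.filter (fun p : ι → Λ => p v = a),
          treeBound (𝕜 := 𝕜) c (fun f => α f (p (c f))) (fun f => β f (p (c f))) univ T ≤ Cst := by
    intro T hT
    obtain ⟨k, -, s, hs, huniv, rfl⟩ := mem_lineSets.1 hT
    have hk : k + 1 = Fintype.card ι := by
      rw [← Script.card_image_y s hs, huniv, card_univ]
    have hlen : s.lines.length = Fintype.card ι - 1 := by rw [Script.length_lines]; omega
    -- the tree bound of `T = lines(s)` at position `p` is at most `(2n²)^k ∏_ℓ γ(...)`
    have hbound : ∀ p : ι → Λ,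
        treeBound (𝕜 := 𝕜) c (fun f => α f (p (c f))) (fun f => β f (p (c f))) univ s.lines.toFinset ≤
          (2 * (n : ℝ) ^ 2) ^ (Fintype.card ι - 1) * s.lineWeightProd (fun _ => γ) (p ∘ s.y) := by
      intro p
      rw [← assignBound_lines_eq_treeBound c _ _ s hs univ, ← hlen, ← prod_map_lines_eq_lineWeightProd γ hγ p s,
        ← prod_map_const_mul]
      refine assignBound_le_prod c _ _ (enum c univ) (fun a => hα _ _) (fun b => hβ _ _) (lineWeight γ hγ p)
        (fun ℓ => Sym2.inductionOn ℓ fun u w => by rw [lineWeight_mk]; exact hγ0 _) (fun a b => ?_) n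
        (fun x => (card_filter_enum_le c univ x).trans (hn x)) s.lines ∅ id
      rw [lineWeight_mk]
      exact hG _ _ _ _
    calc ∑ p ∈ univ.filter (fun p : ι → Λ => p v = a),
          treeBound (𝕜 := 𝕜) c (fun f => α f (p (c f))) (fun f => β f (p (c f))) univ s.lines.toFinset
        ≤ ∑ p ∈ univ.filter (fun p : ι → Λ => p v = a),
            (2 * (n : ℝ) ^ 2) ^ (Fintype.card ι - 1) * s.lineWeightProd (fun _ => γ) (p ∘ s.y) :=
          sum_le_sum fun p _ => hbound p
      _ = (2 * (n : ℝ) ^ 2) ^ (Fintype.card ι - 1) * (∑ z, γ z) ^ k := by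
          rw [← Finset.mul_sum, sum_lineWeightProd_comp_eq_pow s hs huniv γ a]
      _ = Cst := by rw [hCst, show k = Fintype.card ι - 1 by omega, ← mul_pow]
  -- Step 3: Cayley
  calc ∑ T ∈ lineSets v (univ : Finset ι), ∑ p ∈ univ.filter (fun p : ι → Λ => p v = a),
        treeBound (𝕜 := 𝕜) c (fun f => α f (p (c f))) (fun f => β f (p (c f))) univ T
      ≤ ∑ _T ∈ lineSets v (univ : Finset ι), Cst := sum_le_sum step2
    _ = (lineSets v (univ : Finset ι)).card * Cst := by rw [sum_const, nsmul_eq_mul]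
    _ ≤ (Fintype.card ι : ℝ) ^ (Fintype.card ι - 2) * Cst := by
        refine mul_le_mul_of_nonneg_right ?_ (by positivity)
        have h := card_lineSets_le_pow hv
        rw [card_univ] at h
        exact_mod_cast h

end Main

end FermionicTree

end Literature.MathematicalPhysics.QuantumLattice
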